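import Mathlib
import Literature.Probability.LatticeModels.GKSInequalities
import Summits.CriticalPhenomena.Ising3DConformalLimit.Theorems.PrecisionLaplacianInverseMFerromagnetPcovOfIm
import HarnessLib

/-!
# Crux `PrecisionLaplacian.InverseMFerromagnet` (stmt-CriticalPhenomena-4798), line `Sketch` —
# stub `helper_oneSum_precision` (core D structural: the precision matrix of a 1-sum)

THEOREM-ONLY file (no definitions).  Let `G = (⟨σ_pσ_q⟩)_{p,q}` be the spin second-moment matrix
of the zero-field pair ferromagnet `gksExpect univ K C` on `Fin n` (`|C i| = 2`), and suppose every
bond lies inside `A` or inside `B := insert v Aᶜ`, where `v ∈ A` (so `A ∩ B = {v}`: the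
interaction graph is a 1-sum of its pieces on `A` and on `B`, glued at the cut vertex `v`).  We
prove

  `G⁻¹ = [ (G_AA)⁻¹ ]⁰ + [ (G_BB)⁻¹ ]⁰ − e_v e_vᵀ`,

the padded inverses of the two principal submatrices minus the unit entry at `(v,v)`.

Proof.  STEP 1 (the only Ising input, `oneSum_gksSum_factor` / `oneSum_factor`): for `x ∈ A`,
`y ∈ B`, `⟨σ_xσ_y⟩ = ⟨σ_xσ_v⟩⟨σ_vσ_y⟩`.  In Ginibre's duplicated system `(ω, ω')` the map `Φ`
which replaces the spins of `ω` outside `A` by `ω_vω'_v ω'` and those of `ω'` by `ω_vω'_v ω` is an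
involution preserving `w(ω)w(ω')` (bonds inside `A` are untouched, bonds inside `B` are exchanged
between the two copies, using `ω_v² = 1`), and it carries `σ_x(ω)σ_y(ω)` to
`σ_x(ω)σ_v(ω)σ_v(ω')σ_y(ω')`; summing gives `Z⟨σ_xσ_y⟩·Z = Z⟨σ_xσ_v⟩·Z⟨σ_vσ_y⟩`.
STEP 2 (linear algebra, `G` positive definite by `pcov_posDef_of_eq`, `G_vv = 1`): with `M` the
right-hand side, `(M G)_pq = δ_pq` row by row (`oneSum_padded_mul`: a padded inverse times `G` is
`δ_pq` on its block and `δ_pv G_vq` off it, by STEP 1), hence `G⁻¹ = M` (`Matrix.inv_eq_left_inv`).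
-/

namespace Summit.CriticalPhenomena.Ising3DConformalLimit.Cruxes.InverseMFerromagnet.PartialCovarianceLadder

open Literature.Probability.LatticeModels Finset Matrix

/-! ## Step 1: the two-point function factorises through a cut vertex -/

/-- **Markov factorisation across a cut vertex, unnormalised.** If every bond of a pair system
(`|C i| = 2`) lies inside `A` or inside `insert v Aᶜ` (`v ∈ A`), then for `x ∈ A`, `y ∉ A`:
`(∑ σ_xσ_y w)(∑ w) = (∑ σ_xσ_v w)(∑ σ_vσ_y w)`.  Proof by the involution of the duplicated system
described in the module docstring. [folklore] -/
theorem oneSum_gksSum_factor {n m : ℕ} (K : Fin m → ℝ) (C : Fin m → Finset (Fin n))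
    (hC : ∀ i, (C i).card = 2) (v : Fin n) (A : Finset (Fin n)) (hv : v ∈ A)
    (hAB : ∀ i, C i ⊆ A ∨ C i ⊆ insert v Aᶜ) {x y : Fin n} (hx : x ∈ A) (hy : y ∉ A) :
    gksSum Finset.univ K C (fun ω => spinAt x ω * spinAt y ω) * gksSum Finset.univ K C (fun _ => 1)
      = gksSum Finset.univ K C (fun ω => spinAt x ω * spinAt v ω)
        * gksSum Finset.univ K C (fun ω => spinAt v ω * spinAt y ω) := by
  -- the involution `Φ` on pairs of configurations
  obtain ⟨Φ, hΦdef⟩ : ∃ Φ : SpinConfig (Fin n) × SpinConfig (Fin n) →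
      SpinConfig (Fin n) × SpinConfig (Fin n),
      Φ = fun pr => (fun z => if z ∈ A then pr.1 z else pr.1 v * pr.2 v * pr.2 z,
        fun z => if z ∈ A then pr.2 z else pr.1 v * pr.2 v * pr.1 z) := ⟨_, rfl⟩
  have huu : ∀ a b c : ℤˣ, a * b * (a * b * c) = c := fun a b c => by
    rw [← mul_assoc, Int.units_mul_self, one_mul]
  have hΦ : Function.Involutive Φ := by
    rintro ⟨ω, ω'⟩
    subst hΦdef
    refine Prod.ext ?_ ?_ <;> funext z <;> by_cases hz : z ∈ A <;> simp [hz, hv, huu]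
  -- spins of the transformed pair
  have hs1 : ∀ (pr : SpinConfig (Fin n) × SpinConfig (Fin n)) (z : Fin n), spinAt z (Φ pr).1
      = if z ∈ A then spinAt z pr.1 else spinAt v pr.1 * spinAt v pr.2 * spinAt z pr.2 := by
    intro pr z
    subst hΦdef
    by_cases hz : z ∈ A <;> simp [spinAt, hz, Units.val_mul, Int.cast_mul]
  have hs2 : ∀ (pr : SpinConfig (Fin n) × SpinConfig (Fin n)) (z : Fin n), spinAt z (Φ pr).2
      = if z ∈ A then spinAt z pr.2 else spinAt v pr.1 * spinAt v pr.2 * spinAt z pr.1 := by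
    intro pr z
    subst hΦdef
    by_cases hz : z ∈ A <;> simp [spinAt, hz, Units.val_mul, Int.cast_mul]
  -- the product of the two weights is invariant: bonds inside `A` are untouched, bonds inside
  -- `insert v Aᶜ` are exchanged between the two copies
  have hw : ∀ pr : SpinConfig (Fin n) × SpinConfig (Fin n),
      gksWeight Finset.univ K C (Φ pr).1 * gksWeight Finset.univ K C (Φ pr).2
        = gksWeight Finset.univ K C pr.1 * gksWeight Finset.univ K C pr.2 := by
    intro pr
    rw [gksWeight, gksWeight, gksWeight, gksWeight, ← Real.exp_add, ← Real.exp_add]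
    congr 1
    simp only [gksHamiltonian, ← Finset.sum_add_distrib]
    refine Finset.sum_congr rfl fun i _ => ?_
    obtain ⟨a, b, hab, hCi⟩ := Finset.card_eq_two.1 (hC i)
    have s1 := spinAt_mul_self v pr.1
    have s2 := spinAt_mul_self v pr.2
    rw [← mul_add, ← mul_add, hCi, spinProduct, spinProduct, spinProduct, spinProduct,
      Finset.prod_pair hab, Finset.prod_pair hab, Finset.prod_pair hab, Finset.prod_pair hab,
      hs1, hs1, hs2, hs2]
    congr 1
    have haC : a ∈ C i := by rw [hCi]; simp
    have hbC : b ∈ C i := by rw [hCi]; simp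
    rcases hAB i with hiA | hiB
    · simp only [hiA haC, hiA hbC, if_true]
    · have ha : a = v ∨ a ∉ A := by
        simpa [Finset.mem_insert, Finset.mem_compl] using hiB haC
      have hb : b = v ∨ b ∉ A := by
        simpa [Finset.mem_insert, Finset.mem_compl] using hiB hbC
      by_cases hav : a = v
      · have hb' : b ∉ A := hb.resolve_left fun h => hab (hav.trans h.symm)
        rw [hav]
        simp only [hv, hb', if_true, if_false]
        linear_combination (spinAt v pr.2 * spinAt b pr.2) * s1
          + (spinAt v pr.1 * spinAt b pr.1) * s2
      · have ha' : a ∉ A := ha.resolve_left hav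
        by_cases hbv : b = v
        · rw [hbv]
          simp only [hv, ha', if_true, if_false]
          linear_combination (spinAt v pr.2 * spinAt a pr.2) * s1
            + (spinAt v pr.1 * spinAt a pr.1) * s2
        · have hb' : b ∉ A := hb.resolve_left hbv
          simp only [ha', hb', if_false]
          linear_combination (spinAt a pr.1 * spinAt b pr.1 + spinAt a pr.2 * spinAt b pr.2)
            * (spinAt v pr.1 * spinAt v pr.1 * s2 + s1)
  -- both sides as sums over pairs of configurations; reindex the left-hand one by `Φ`
  have key : ∑ pr : SpinConfig (Fin n) × SpinConfig (Fin n),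
      spinAt x pr.1 * spinAt y pr.1 * gksWeight Finset.univ K C pr.1
        * (1 * gksWeight Finset.univ K C pr.2)
      = ∑ pr : SpinConfig (Fin n) × SpinConfig (Fin n),
        spinAt x pr.1 * spinAt v pr.1 * gksWeight Finset.univ K C pr.1
          * (spinAt v pr.2 * spinAt y pr.2 * gksWeight Finset.univ K C pr.2) := by
    rw [← Equiv.sum_comp (Function.Involutive.toPerm Φ hΦ)]
    refine Finset.sum_congr rfl fun pr _ => ?_
    rw [Function.Involutive.coe_toPerm, hs1 pr x, hs1 pr y, if_pos hx, if_neg hy]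
    calc spinAt x pr.1 * (spinAt v pr.1 * spinAt v pr.2 * spinAt y pr.2)
          * gksWeight Finset.univ K C (Φ pr).1 * (1 * gksWeight Finset.univ K C (Φ pr).2)
        = spinAt x pr.1 * (spinAt v pr.1 * spinAt v pr.2 * spinAt y pr.2)
          * (gksWeight Finset.univ K C (Φ pr).1 * gksWeight Finset.univ K C (Φ pr).2) := by ring
      _ = _ := by rw [hw pr]; ring
  unfold gksSum
  rw [Finset.sum_mul_sum, Finset.sum_mul_sum, ← Fintype.sum_prod_type', ← Fintype.sum_prod_type']
  exact key

/-- **Markov factorisation across a cut vertex.** Under the 1-sum hypothesis (every bond inside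
`A` or inside `insert v Aᶜ`, `v ∈ A`, `|C i| = 2`), for `x ∈ A` and `y ∈ insert v Aᶜ`:
`⟨σ_xσ_y⟩ = ⟨σ_xσ_v⟩⟨σ_vσ_y⟩` (for `y = v` this is `⟨σ_vσ_v⟩ = 1`). [folklore] -/
theorem oneSum_factor {n m : ℕ} (K : Fin m → ℝ) (C : Fin m → Finset (Fin n))
    (hC : ∀ i, (C i).card = 2) (v : Fin n) (A : Finset (Fin n)) (hv : v ∈ A)
    (hAB : ∀ i, C i ⊆ A ∨ C i ⊆ insert v Aᶜ) {x y : Fin n} (hx : x ∈ A)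
    (hy : y ∈ insert v Aᶜ) :
    gksExpect Finset.univ K C (fun ω => spinAt x ω * spinAt y ω)
      = gksExpect Finset.univ K C (fun ω => spinAt x ω * spinAt v ω)
        * gksExpect Finset.univ K C (fun ω => spinAt v ω * spinAt y ω) := by
  have hZ := gksSum_one_pos Finset.univ K C
  rcases Finset.mem_insert.1 hy with rfl | hy'
  · have h1 : gksExpect Finset.univ K C (fun ω => spinAt y ω * spinAt y ω) = 1 := by
      simp_rw [spinAt_mul_self]
      exact div_self hZ.ne'
    rw [h1, mul_one]
  · have key := oneSum_gksSum_factor K C hC v A hv hAB hx (Finset.mem_compl.1 hy')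
    unfold gksExpect
    rw [div_mul_div_comm, div_eq_div_iff hZ.ne' (mul_pos hZ hZ).ne']
    linear_combination gksSum Finset.univ K C (fun _ => 1) * key

/-! ## Step 2: linear algebra -/

/-- `∑_r (if r ∈ S then a_r else 0) = ∑_{r : S} a_r`. [folklore] -/
theorem oneSum_sum_dite_mem {ι : Type*} [Fintype ι] [DecidableEq ι] (S : Finset ι) (a : ↥S → ℝ) :
    ∑ r, (if h : r ∈ S then a ⟨r, h⟩ else 0) = ∑ r : ↥S, a r := by
  have h1 : ∑ r : ↥S, a r = ∑ r : ↥S, (fun i => if h : i ∈ S then a ⟨i, h⟩ else 0) r.1 :=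
    Finset.sum_congr rfl fun r _ => by simp only [dif_pos r.2]
  rw [h1, Finset.sum_coe_sort S (fun i => if h : i ∈ S then a ⟨i, h⟩ else 0)]
  exact (Finset.sum_subset (Finset.subset_univ S) fun r _ hr => dif_neg hr).symm

/-- **A padded inverse of a principal block times the full matrix.** For `G` positive definite,
`v ∈ S`, and the factorisation `G_rq = G_rv G_vq` for `r ∈ S`, `q ∉ S`: the row `p` of
`[ (G_SS)⁻¹ ]⁰ G` is `δ_pq` for `q ∈ S` and `δ_pv G_vq` for `q ∉ S` (and `0` if `p ∉ S`). [folklore] -/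
theorem oneSum_padded_mul {n : ℕ} (G : Matrix (Fin n) (Fin n) ℝ) (hPD : G.PosDef)
    (S : Finset (Fin n)) (v : Fin n) (hv : v ∈ S)
    (hfac : ∀ r ∈ S, ∀ q ∉ S, G r q = G r v * G v q) (p q : Fin n) :
    ∑ r, (if h : p ∈ S ∧ r ∈ S then
        (G.submatrix (Subtype.val : ↥S → Fin n) (Subtype.val : ↥S → Fin n))⁻¹ ⟨p, h.1⟩ ⟨r, h.2⟩
      else 0) * G r q
      = if p ∈ S then (if q ∈ S then (if p = q then 1 else 0) else (if p = v then 1 else 0) * G v q)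
        else 0 := by
  by_cases hp : p ∈ S
  · set X := G.submatrix (Subtype.val : ↥S → Fin n) (Subtype.val : ↥S → Fin n) with hX
    have hXX : X⁻¹ * X = 1 := Matrix.nonsing_inv_mul X
      ((Matrix.isUnit_iff_isUnit_det X).mp (hPD.submatrix Subtype.val_injective).isUnit)
    have hone : ∀ (z : Fin n) (hz : z ∈ S), ∑ r : ↥S, X⁻¹ ⟨p, hp⟩ r * G r.1 z
        = if p = z then 1 else 0 := by
      intro z hz
      have h := congrFun (congrFun hXX ⟨p, hp⟩) ⟨z, hz⟩
      rw [Matrix.mul_apply, Matrix.one_apply] at h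
      simp only [Subtype.mk.injEq] at h
      rw [← h]
      rfl
    have hsum : ∑ r, (if h : p ∈ S ∧ r ∈ S then X⁻¹ ⟨p, h.1⟩ ⟨r, h.2⟩ else 0) * G r q
        = ∑ r : ↥S, X⁻¹ ⟨p, hp⟩ r * G r.1 q := by
      have hterm : ∀ r, (if h : p ∈ S ∧ r ∈ S then X⁻¹ ⟨p, h.1⟩ ⟨r, h.2⟩ else 0) * G r q
          = if h : r ∈ S then X⁻¹ ⟨p, hp⟩ ⟨r, h⟩ * G r q else 0 := by
        intro r
        by_cases hr : r ∈ S
        · rw [dif_pos ⟨hp, hr⟩, dif_pos hr]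
        · rw [dif_neg (fun h => hr h.2), dif_neg hr, zero_mul]
      rw [Finset.sum_congr rfl (fun r _ => hterm r)]
      exact oneSum_sum_dite_mem S (fun r => X⁻¹ ⟨p, hp⟩ r * G r.1 q)
    rw [hsum, if_pos hp]
    by_cases hq : q ∈ S
    · rw [if_pos hq, hone q hq]
    · rw [if_neg hq, ← hone v hv, Finset.sum_mul]
      refine Finset.sum_congr rfl fun r _ => ?_
      rw [hfac r.1 r.2 q hq, mul_assoc]
  · rw [if_neg hp]
    exact Finset.sum_eq_zero fun r _ => by rw [dif_neg (fun h => hp h.1), zero_mul]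

/-! ## The registered stub -/

/-- Registered stub `helper_oneSum_precision` (core D structural fact of line `Sketch`): **the
precision matrix of a 1-sum.**  If every bond of the zero-field pair ferromagnet lies inside `A`
or inside `B = insert v Aᶜ` (`v ∈ A` the cut vertex), then
`G⁻¹ = [ (G_AA)⁻¹ ]⁰ + [ (G_BB)⁻¹ ]⁰ − e_ve_vᵀ` for the second-moment matrix `G = (⟨σ_pσ_q⟩)`.
By the Markov factorisation `⟨σ_xσ_y⟩ = ⟨σ_xσ_v⟩⟨σ_vσ_y⟩` (`x ∈ A`, `y ∈ B`, `oneSum_factor`)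
the right-hand side `M` satisfies `M G = 1` (`oneSum_padded_mul`, `G_vv = 1`), and `G` is
positive definite (`pcov_posDef_of_eq`), so `G⁻¹ = M`. [folklore] -/
theorem helper_oneSum_precision :
    ∀ (n m : ℕ) (K : Fin m → ℝ) (C : Fin m → Finset (Fin n)), (∀ i, 0 ≤ K i) → (∀ i, (C i).card = 2) →
      ∀ (v : Fin n) (A : Finset (Fin n)), v ∈ A → (∀ i, C i ⊆ A ∨ C i ⊆ insert v Aᶜ) →
        ∀ G : Matrix (Fin n) (Fin n) ℝ,
          G = Matrix.of (fun p q : Fin n => gksExpect Finset.univ K C (fun ω => spinAt p ω * spinAt q ω)) →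
          ∀ p q : Fin n,
            G⁻¹ p q =
              (if h : p ∈ A ∧ q ∈ A then
                  (G.submatrix (Subtype.val : ↥A → Fin n) (Subtype.val : ↥A → Fin n))⁻¹ ⟨p, h.1⟩ ⟨q, h.2⟩
               else 0)
              + (if h : p ∈ insert v Aᶜ ∧ q ∈ insert v Aᶜ then
                  (G.submatrix (Subtype.val : ↥(insert v Aᶜ) → Fin n)
                      (Subtype.val : ↥(insert v Aᶜ) → Fin n))⁻¹ ⟨p, h.1⟩ ⟨q, h.2⟩
               else 0)
              - (if p = v ∧ q = v then 1 else 0) := by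
  intro n m K C _ hC v A hv hAB G hG
  -- facts about `G`
  have hPD : G.PosDef := pcov_posDef_of_eq hG
  have hsymm : ∀ p q, G p q = G q p := fun p q => by
    simp only [hG, Matrix.of_apply]
    exact congrArg _ (funext fun ω => mul_comm _ _)
  have hvv : G v v = 1 := by
    simp only [hG, Matrix.of_apply, spinAt_mul_self]
    exact div_self (gksSum_one_pos _ K C).ne'
  have hfac : ∀ x ∈ A, ∀ y ∈ insert v Aᶜ, G x y = G x v * G v y := fun x hx y hy => by
    simp only [hG, Matrix.of_apply]
    exact oneSum_factor K C hC v A hv hAB hx hy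
  -- membership bookkeeping for `B = insert v Aᶜ`
  have hvB : v ∈ insert v Aᶜ := Finset.mem_insert_self v _
  have hmemB : ∀ z, z ∈ insert v Aᶜ ↔ z = v ∨ z ∉ A := fun z => by
    rw [Finset.mem_insert, Finset.mem_compl]
  have hfacA : ∀ r ∈ A, ∀ q ∉ A, G r q = G r v * G v q := fun r hr q hq =>
    hfac r hr q ((hmemB q).2 (Or.inr hq))
  have hfacB : ∀ r ∈ insert v Aᶜ, ∀ q ∉ insert v Aᶜ, G r q = G r v * G v q := by
    intro r hr q hq
    have hqA : q ∈ A := by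
      by_contra h
      exact hq ((hmemB q).2 (Or.inr h))
    rw [hsymm r q, hfac q hqA r hr, hsymm q v, hsymm v r, mul_comm]
  -- the candidate inverse `M` and `M G = 1`
  obtain ⟨M, hM⟩ : ∃ M : Matrix (Fin n) (Fin n) ℝ, M = Matrix.of fun p q : Fin n =>
      (if h : p ∈ A ∧ q ∈ A then
          (G.submatrix (Subtype.val : ↥A → Fin n) (Subtype.val : ↥A → Fin n))⁻¹ ⟨p, h.1⟩ ⟨q, h.2⟩
        else 0)
      + (if h : p ∈ insert v Aᶜ ∧ q ∈ insert v Aᶜ then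
          (G.submatrix (Subtype.val : ↥(insert v Aᶜ) → Fin n)
              (Subtype.val : ↥(insert v Aᶜ) → Fin n))⁻¹ ⟨p, h.1⟩ ⟨q, h.2⟩
        else 0)
      - (if p = v ∧ q = v then 1 else 0) := ⟨_, rfl⟩
  have hMG : M * G = 1 := by
    ext p q
    rw [Matrix.mul_apply, hM]
    simp only [Matrix.of_apply, sub_mul, add_mul, Finset.sum_sub_distrib, Finset.sum_add_distrib]
    rw [oneSum_padded_mul G hPD A v hv hfacA p q,
      oneSum_padded_mul G hPD (insert v Aᶜ) v hvB hfacB p q]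
    have h3 : ∑ r, (if p = v ∧ r = v then (1 : ℝ) else 0) * G r q = if p = v then G v q else 0 := by
      by_cases hpv : p = v
      · simp [hpv]
      · simp [hpv]
    rw [h3, Matrix.one_apply]
    by_cases hpv : p = v
    · subst hpv
      by_cases hqp : q = p
      · subst hqp
        simp [hv, hvv]
      · have hne : ¬ p = q := fun h => hqp h.symm
        by_cases hqA : q ∈ A
        · have hqB : q ∉ insert p Aᶜ := fun h => by
            rcases (hmemB q).1 h with h | h
            · exact hqp h
            · exact h hqA
          simp [hv, hvB, hqA, hqB, hne]
        · have hqB : q ∈ insert p Aᶜ := (hmemB q).2 (Or.inr hqA)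
          simp [hv, hvB, hqA, hqB, hne]
    · by_cases hpA : p ∈ A
      · have hpB : p ∉ insert v Aᶜ := fun h => by
          rcases (hmemB p).1 h with h | h
          · exact hpv h
          · exact h hpA
        by_cases hqA : q ∈ A
        · simp [hpA, hpB, hqA, hpv]
        · have hne : p ≠ q := fun h => hqA (h ▸ hpA)
          simp [hpA, hpB, hqA, hpv, hne]
      · have hpB : p ∈ insert v Aᶜ := (hmemB p).2 (Or.inr hpA)
        by_cases hqB : q ∈ insert v Aᶜ
        · simp [hpA, hpB, hqB, hpv]
        · have hne : p ≠ q := fun h => hqB (h ▸ hpB)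
          simp [hpA, hpB, hqB, hpv, hne]
  intro p q
  rw [Matrix.inv_eq_left_inv hMG, hM, Matrix.of_apply]

end Summit.CriticalPhenomena.Ising3DConformalLimit.Cruxes.InverseMFerromagnet.PartialCovarianceLadder
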